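import Literature.MathematicalPhysics.QuantumFieldTheory.Balaban1983to89.Node00.TorusCoverLandau153Box
import Literature.MathematicalPhysics.QuantumFieldTheory.Balaban1983to89.Node00.TorusCoverGaugeTokens152153Print

/-!
# NODE 00 — THE (152) STEP WITH ALL FOUR LETTERS AND (153) `R ∂*a = 0` ON THE BOX WINDOW `π(𝔔)` OF THE PRINT DATUM OF EVERY GRID CUBE OF A CLASS MEMBER, AT THE
# RECORD'S FAMILIES `F : T4Family`: generation 0's `gauge152_153_of_prop6P` (⟸ [6] Proposition 6 ON PRINT'S CLASS `zdCubP`) re-run through generation 3's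
# `exists_localGauge152_RE153_coverBox_propCubeP_of_prop6P`

Cell `pub-ymgap`, width seat `pub-ymgap-dag-n07-w3` generation 3, INTENT-2 (cell INBOX 2026-08-28; the families-level twin of INTENT-1 for the S6 consumer
`pub-ymgap-dag-n07-w4`, whose tokens live on `F : T4Family` and on the window `π '' box(propCubeP …)`).  NEW leaf, PROOF kind (no `def`, no `instance`, no `notation`).
CONSUMED BY NAME, nothing modified: this seat's `Node00.TorusCoverLandau153Box` (`exists_localGauge152_RE153_coverBox_propCubeP_of_prop6P`) and generation 0's
`Node00.TorusCoverGaugeTokens152153Print` (`gauge152_153_of_prop6P` — its proof VERBATIM up to the last line: the print side `M′ = sideP ≤ M₀ + 44 + 2ρ`, the collar clause from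
`Sect2.SeqSeparated` ∕ the hull at `n = 1` under the floor `(11·4 + 4ρ)·L ≤ M₁`, print's «7dL²M′α₀ ≤ c₁» and the `2π`-window from `ε_{n−1} ≤ a0OfP`, the letters at
`2r < b9OfP·ε_n`); dag-n07-e's FILE P3 `Node00.TorusCoverGaugeTokensRPrint` (`b9OfP`, `a0OfP`, `a0OfP_pos`) and FILE P1 (`propCubeP`, `cubeIdxP'`, `sideP`, `sideP_le`, `le_sideP`,
`cover_image_Ω_cubeIdxP'_subset`, `cover_image_Ω_cubeIdxP'_one_subset_hullD`, `boxWidth_propCubeP`), module 39 `cubeDomains`; k0-s2-w2's `prop6Printed_zdCubP_anti`; def-R's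
`suppDomOfRecord`; N07's `Prop8RegSepTopStep` (HYPOTHESIS); lit-balaban p21's `RE` ∕ `dsE`.  `--kind proof --supports stmt-QuantumFields-20542` (K1⁷; count-neutral).
[15] = [Balaban1985Variational]; [6] = [Balaban1985RegularSpaces]; [B6] = [Balaban1984PropagatorsII]; [III] = [Balaban1988Convergent].

WHY.  Generation 0's families-level token extracts the (152) letters on a GRID cube `cubeEnl (F.P K) (LⁿM₀) a 0` and carries (153) for the `ℤᵈ` lift in member currency.
The S6 assembly at the record places every plaquette ∕ bond stencil in the image `π(𝔔)` of the print DATUM box of its grid cube (dag-n07-w4's `TorusCoverBoxStencilsPrint`),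
and reads (153) in lit-balaban's letters `RE D η⁻¹ (dsE η⁻¹ a) = 0` for the datum's torus tower `D = cubeDomains`.  THIS FILE is the same token with (i) the window
`π(𝔔) = cover '' box L (propCubeP …).a (propCubeP …).M n`, (ii) the last conjunct `R ∂*a = 0` for `a = Re ∕ Im(φ∘A)` on `cubeDomains (F.P K) (propCubeP …).a (propCubeP …).M ρ n _`,
(iii) the grid-cube non-wrapping binder `hSN` replaced by the non-wrapping of the datum's collared cube `Set.InjOn (cover (F.P K)) (cube L (propCubeP …).a (propCubeP …).M
(propCubeP …).ρ n 0)` (the conclusion letter of `pub-ymgap-k0-s1-w3`'s collar numerics) and `n ≤ m + K`, and (iv) `1 ≤ M` (the datum box is never empty, so generation 0's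
empty-cube shortcut at `M = 0` is not available — the collar clause needs a non-empty grid cube inside `Ω_n`).

CONTENTS.  §1 ★★★ `gauge152_RE153_box_of_prop6P` · ★ `gauge152_RE153_box_of_prop6P_of_one_le` (stub 2′'s bare `ρ₀ ≥ 1`, `ρ := ρ₀·L`).
§2 ★★ `gauge9_152_RE153_box_of_prop8TopStep_of_prop6P` (the (9)–(10) composition for critical configurations at the radii `B₃δ_•`; stub 1's fact as HYPOTHESIS).

HONEST FRAMING: compositions by name; [6] Proposition 6 on print's class at the member is the HYPOTHESIS `hP6` (N05's node ∕ stub 2′'s body; never asserted here); stub 1's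
`Prop8RegSepTopStep` is the HYPOTHESIS `h8` of §2; the non-wrapping of the datum's collared cube is DISPLAYED; nothing of Bałaban discharged; stub 2′ ∕ N07 ∕ N05 ∕ K0⁷ ∕ K1⁷ NOT
closed; counts unmoved (typed 28∕28 · discharged 5∕27); one finite 𝕋⁴ programme at fixed ε — R4 closes the conditional finite-𝕋⁴ rung `BalabanLadder.UV` only; the YM mass gap (Clay) is
NOT proved by any of this; nothing continuum ∕ ℝ⁴ ∕ infinite volume ∕ OS.  No `sorry`, no `def`, no `instance`, no `notation`.
-/

noncomputable section

namespace Literature.MathematicalPhysics.QuantumFieldTheory.Balaban1983to89.Node00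

open scoped Matrix.Norms.L2Operator InnerProductSpace RealInnerProductSpace
open T4Continuum (T4Family)
open B15DeterminingSets B12RegularSpaces111
open B15Eq112TorusCover (cover)
open B14DomainGeom (Pt)
open B14.Eq213MaximalDomains (side cubeExt)
open B7Prop1Explicit (e)
open B8Eq131Cubes (box cube tcube bLo bHi)
open B8LeafModelZd (ZdIdx)
open B6SectAOperatorsV1 (RE dsE)
open BalabanImbrieJaffe1984to88.BIJ85AxialPropagator411 (BondSpace)

variable {F : T4Family} {N : ℕ} [NeZero N]

/-! ## §1  ★★★ The five (152) clauses on the box window and (153) `R ∂*a = 0`, on every grid cube of a class member, from [6] Prop. 6 on print's class -/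

section Wrapper

/-- ★★★ **[15] (152) WITH ALL FOUR LETTERS ON THE BOX WINDOW `π(𝔔)` OF THE PRINT DATUM OF A GRID CUBE, AND (153) `R ∂*a = 0` IN lit-balaban's LETTERS FOR THE SAME POTENTIAL
⟸ [6] PROP. 6 ON PRINT'S CUBE CLASS AT THE MEMBER** — generation 0's `gauge152_153_of_prop6P` binder block (a separated index `s` with the floor `(11·4 + 4ρ)·L ≤ ν.M₁`; level radii
`0 < ε_m ≤ a0OfP F N M ρ B₁ c₁` with `ε_m ≤ 2ε_{m+1}`; `U` in the (1.7)∕(1.9)-Top class over `suppDomOfRecord`; a scale `1 ≤ n ≤ k`, here also `n ≤ m + K`; the cube letter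
`M₀ ∈ {M, L·M}` with `1 ≤ M`; a grid cube `□ = cubeEnl (F.P K) (LⁿM₀) a 0 ⊆ Ω_n`) with the grid-cube non-wrapping replaced by the non-wrapping of the datum's collared cube
`Set.InjOn (cover (F.P K)) (cube L 𝔔.a 𝔔.M 𝔔.ρ n 0)`, `𝔔 = propCubeP (F.P K) n hn1 M₀ ρ hρ a`.  CONCLUSION: an `SU(N)` gauge `u` and a potential `A` with `(ι∘U)^{ι∘u} = e^{iη_nA}`,
`‖A‖ < b9OfP·ε_n` on the bonds of `Sect2.regionOfSet (F.P K) (π(𝔔))`, `‖∇^{η_n}A‖ < b9OfP·ε_n` on its stencils, `‖∂^{η_n*}∂^{η_n}A‖ < b9OfP·ε_n` and `‖Δ^{η_n}A‖ < b9OfP·ε_n` on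
`Sect2.bondsDeep (π(𝔔))`, AND `RE (cubeDomains (F.P K) 𝔔.a 𝔔.M ρ n _) η_n⁻¹ (dsE η_n⁻¹ a) = 0` for `a = Re ∕ Im(φ∘A)`, every `φ : M_N(ℂ) →L[ℂ] ℂ` ([B6] (2.12)'s projection onto
`ΔN(Q′)` of the datum's torus tower).  Prop. 6 on print's class is the HYPOTHESIS `hP6`.
[cite: Balaban1985Variational, (144)–(153) pp.300–301, Thm 1 (10) p.279; Balaban1985RegularSpaces, Prop. 6 (1.135)–(1.138) p.99, p.98, (1.38) p.82; Balaban1984PropagatorsII, (2.10)–(2.12) p.225; Balaban1988Convergent, (2.13) p.256, p.255] -/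
theorem gauge152_RE153_box_of_prop6P {B₁ c₁ : ℝ} (hB₁ : 0 ≤ B₁) (hc₁ : 0 < c₁) {ρ : ℕ}
    (hP6 : letI : CStarAlgebra (MatA N) := {}; B8.Prop6Printed 4 (F.L : ℝ) B₁ c₁ (fun i : ZdIdx 4 F.L => zdCubP (MatA N) F.L ρ i)) {M : ℕ} (hM : 1 ≤ M)
    (ν : Stage7Numerics) (g : ℕ → ℝ) (K k : ℕ) (hρ : (F.P K).L ≤ ρ) (s : SeqOfRecord F ν M g K k) (hsep : Sect2.SeqSeparated ν.M₁ s)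
    (hfloor : (11 * 4 + 4 * ρ) * F.L ≤ ν.M₁) (ε : ℕ → ℝ)
    (hε : ∀ m, m ≤ k → 0 < ε m ∧ ε m ≤ a0OfP F N M ρ B₁ c₁) (hcomp : ∀ m, m < k → ε m ≤ 2 * ε (m + 1))
    (U : GaugeField (F.P K) 0 (SU N))
    (h17 : ∀ m, m ≤ k → PlaqSmallOn (Sect2.omegaPlaqsTop s.Ω (suppDomOfRecord F ν K s.Ω) m) (ε m * (F.P K).eta m ^ 2) U)
    (h19 : ∀ m, m ≤ k → Sect2.CoDivSmallOn (Sect2.omegaBondsTop s.Ω (suppDomOfRecord F ν K s.Ω) m) (ε m * (F.P K).eta m ^ 3) U)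
    {n : ℕ} (hn1 : 1 ≤ n) (hnk : n ≤ k) (hnK : n ≤ (F.P K).m + (F.P K).K) {M₀ : ℕ} (hM₀ : M₀ = M ∨ M₀ = F.L * M)
    (a : Pt (F.P K).d) (hΩ : cubeEnl (F.P K) (side (F.P K).L M₀ n) a 0 ⊆ s.Ω n)
    (hinj : Set.InjOn (cover (F.P K))
      (cube (F.P K).L (propCubeP (F.P K) n hn1 M₀ ρ hρ a).a (propCubeP (F.P K) n hn1 M₀ ρ hρ a).M (propCubeP (F.P K) n hn1 M₀ ρ hρ a).ρ n 0)) :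
    ∃ u : GaugeTransf (F.P K) 0 (SU N), ∃ A : PBond (F.P K) 0 → MatA N,
      (∀ b ∈ (Sect2.regionOfSet (F.P K)
          (cover (F.P K) '' box (F.P K).L (propCubeP (F.P K) n hn1 M₀ ρ hρ a).a (propCubeP (F.P K) n hn1 M₀ ρ hρ a).M n)).bonds,
          gaugeU (fun x => ιSU N (u x)) (fun b' => ιSU N (U b')) b = expI ((F.P K).eta n) (A b)) ∧
      (∀ b ∈ (Sect2.regionOfSet (F.P K)
          (cover (F.P K) '' box (F.P K).L (propCubeP (F.P K) n hn1 M₀ ρ hρ a).a (propCubeP (F.P K) n hn1 M₀ ρ hρ a).M n)).bonds,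
          ‖A b‖ < b9OfP F M ρ B₁ * ε n) ∧
      (∀ q ∈ (Sect2.regionOfSet (F.P K)
          (cover (F.P K) '' box (F.P K).L (propCubeP (F.P K) n hn1 M₀ ρ hρ a).a (propCubeP (F.P K) n hn1 M₀ ρ hρ a).M n)).dpairs,
          ‖grad ((F.P K).eta n) q.2.1 (fun y => A ⟨y, q.2.2⟩) q.1‖ < b9OfP F M ρ B₁ * ε n) ∧
      (∀ b ∈ Sect2.bondsDeep (cover (F.P K) '' box (F.P K).L (propCubeP (F.P K) n hn1 M₀ ρ hρ a).a (propCubeP (F.P K) n hn1 M₀ ρ hρ a).M n),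
          ‖Sect2.codiffCurlA ((F.P K).eta n) A b.src b.dir‖ < b9OfP F M ρ B₁ * ε n) ∧
      (∀ b ∈ Sect2.bondsDeep (cover (F.P K) '' box (F.P K).L (propCubeP (F.P K) n hn1 M₀ ρ hρ a).a (propCubeP (F.P K) n hn1 M₀ ρ hρ a).M n),
          ‖∑ ν' : Fin (F.P K).d, (((F.P K).eta n : ℝ) : ℂ)⁻¹ •
              (grad ((F.P K).eta n) ν' (fun y => A ⟨y, b.dir⟩) (b.src.unshift ν') - grad ((F.P K).eta n) ν' (fun y => A ⟨y, b.dir⟩) b.src)‖ <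
            b9OfP F M ρ B₁ * ε n) ∧
      (∀ φ : MatA N →L[ℂ] ℂ,
          RE (cubeDomains (F.P K) (propCubeP (F.P K) n hn1 M₀ ρ hρ a).a (propCubeP (F.P K) n hn1 M₀ ρ hρ a).M ρ n hnK) ((F.P K).eta n)⁻¹
              (dsE ((F.P K).eta n)⁻¹ (WithLp.toLp 2 fun b => (φ (A b)).re : BondSpace (F.P K))) = 0 ∧
          RE (cubeDomains (F.P K) (propCubeP (F.P K) n hn1 M₀ ρ hρ a).a (propCubeP (F.P K) n hn1 M₀ ρ hρ a).M ρ n hnK) ((F.P K).eta n)⁻¹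
              (dsE ((F.P K).eta n)⁻¹ (WithLp.toLp 2 fun b => (φ (A b)).im : BondSpace (F.P K))) = 0) := by
  letI : CStarAlgebra (MatA N) := {}
  have hL2 : 2 ≤ F.L := (F.P 0).hL.2
  have hd : 2 ≤ (F.P K).d := by rw [T4Family.P_d]; norm_num
  set M₂ : ℕ := F.L * M + 44 + 2 * ρ with hM₂
  have ha₀ := a0OfP_pos (F := F) (N := N) M ρ hB₁ hc₁
  have hεn : 0 < ε n := (hε n hnk).1
  have hMpos : 0 < M := hM
  -- the cube letter `M₀ ∈ {M, LM}` is positive and `M₀ + 44 + 2ρ ≤ M₂` (generation 0's bookkeeping, verbatim)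
  have hM₀pos : 1 ≤ M₀ := by
    rcases hM₀ with h | h
    · rw [h]; exact hMpos
    · rw [h]; exact Nat.one_le_iff_ne_zero.2 (Nat.mul_ne_zero (F.P 0).L_pos.ne' hMpos.ne')
  have hM₀' : M₀ + 44 + 2 * ρ ≤ M₂ := by
    rcases hM₀ with h | h
    · rw [h, hM₂]; nlinarith [(F.P 0).L_pos]
    · rw [h, hM₂]
  have hεn1 : 0 < ε (n - 1) := (hε (n - 1) (by omega)).1
  have hεn1a : ε (n - 1) ≤ a0OfP F N M ρ B₁ c₁ := (hε (n - 1) (by omega)).2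
  have hε2 : ε (n - 1) ≤ 2 * ε n := by
    have := hcomp (n - 1) (by omega)
    rwa [show n - 1 + 1 = n by omega] at this
  -- the print side `M′ = sideP ≤ M₀ + 44 + 2ρ ≤ M₂`
  have hside : sideP (F.P K) M₀ ρ ≤ M₂ := by
    have := sideP_le (P := F.P K) M₀ ρ
    rw [T4Family.P_d] at this
    omega
  have hM'r : ((sideP (F.P K) M₀ ρ : ℕ) : ℝ) ≤ (M₂ : ℝ) := by exact_mod_cast hside
  have hM'pos : (0 : ℝ) < ((sideP (F.P K) M₀ ρ : ℕ) : ℝ) := by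
    have := le_sideP (P := F.P K) M₀ (lt_of_lt_of_le (F.P K).L_pos hρ)
    exact_mod_cast (show 0 < sideP (F.P K) M₀ ρ by omega)
  have hM₂pos : (0 : ℝ) < M₂ := lt_of_lt_of_le hM'pos hM'r
  -- the collar clause
  have hcollar : cover (F.P K) '' (cubeIdxP' (F.P K) n hn1 M₀ ρ a).Ω 0 ⊆
      (if n - 1 = 0 then suppDomOfRecord F ν K s.Ω else s.Ω (n - 1)) := by
    rcases Nat.eq_or_lt_of_le hn1 with h1 | h1
    · subst h1
      rw [if_pos rfl, suppDomOfRecord_eq]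
      exact cover_image_Ω_cubeIdxP'_one_subset_hullD hρ (by rw [T4Family.P_d, T4Family.P_L]; exact hfloor) hM₀pos a hΩ 0
    · rw [if_neg (by omega)]
      refine cover_image_Ω_cubeIdxP'_subset s hsep hρ ?_ h1 hnk hM₀pos a hΩ 0
      rw [T4Family.P_d]
      exact le_trans (Nat.le_mul_of_pos_right _ (F.P 0).L_pos) hfloor
  -- the smallness «7dL²M′α₀ ≤ c₁»
  have ha₀c : a0OfP F N M ρ B₁ c₁ ≤ c₁ / (56 * (F.L : ℝ) ^ 5 * M₂) := by rw [hM₂]; exact min_le_left _ _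
  have ha₀w : a0OfP F N M ρ B₁ c₁ ≤ 1 / (8 * (M₂ : ℝ) * N * (28 * (F.L : ℝ) ^ 5 * B₁ * M₂) + 1) := by rw [hM₂]; exact min_le_right _ _
  have hc₁' : 7 * (F.P K).d * ((F.P K).L : ℝ) ^ 2 * (propCubeP (F.P K) n hn1 M₀ ρ hρ a).M * (((F.P K).L : ℝ) ^ 3 * ε (n - 1)) ≤ c₁ := by
    rw [propCubeP_M, T4Family.P_d, T4Family.P_L]
    have h1 : 7 * (4 : ℕ) * (F.L : ℝ) ^ 2 * ((sideP (F.P K) M₀ ρ : ℕ) : ℝ) * ((F.L : ℝ) ^ 3 * ε (n - 1)) ≤ 28 * (F.L : ℝ) ^ 5 * M₂ * a0OfP F N M ρ B₁ c₁ := by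
      have : 7 * (4 : ℕ) * (F.L : ℝ) ^ 2 * ((sideP (F.P K) M₀ ρ : ℕ) : ℝ) * ((F.L : ℝ) ^ 3 * ε (n - 1)) =
          28 * (F.L : ℝ) ^ 5 * ((sideP (F.P K) M₀ ρ : ℕ) : ℝ) * ε (n - 1) := by push_cast; ring
      rw [this]; gcongr
    have h2 : 28 * (F.L : ℝ) ^ 5 * M₂ * a0OfP F N M ρ B₁ c₁ ≤ 28 * (F.L : ℝ) ^ 5 * M₂ * (c₁ / (56 * (F.L : ℝ) ^ 5 * M₂)) :=
      mul_le_mul_of_nonneg_left ha₀c (by positivity)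
    have h3 : 28 * (F.L : ℝ) ^ 5 * M₂ * (c₁ / (56 * (F.L : ℝ) ^ 5 * M₂)) = c₁ / 2 := by field_simp; ring
    linarith
  -- the `2π`-window of the normalisation
  have h2π : (2 * boxWidth (bLo (F.P K).L (propCubeP (F.P K) n hn1 M₀ ρ hρ a).a n 0)
      (bHi (F.P K).L (propCubeP (F.P K) n hn1 M₀ ρ hρ a).a (propCubeP (F.P K) n hn1 M₀ ρ hρ a).M n 0) + 1) *
      ((F.P K).eta n * N * (7 * (F.P K).d * ((F.P K).L : ℝ) ^ 2 * B₁ * (propCubeP (F.P K) n hn1 M₀ ρ hρ a).M * (((F.P K).L : ℝ) ^ 3 * ε (n - 1)) *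
        (((F.P K).L : ℝ) ^ n * (F.P K).eta n)⁻¹)) < 2 * Real.pi := by
    have hbw := boxWidth_propCubeP (F.P K) n hn1 M₀ ρ hρ a
    rw [propCubeP_k] at hbw
    rw [hbw, propCubeP_M, B12Eq115BackgroundPair.pow_mul_eta, inv_one, mul_one, T4Family.P_d, T4Family.P_L]
    have hη : (F.L : ℝ) ^ n * (F.P K).eta n = 1 := by have := B12Eq115BackgroundPair.pow_mul_eta (F.P K) n; rwa [T4Family.P_L] at this
    have hηpos : 0 < (F.P K).eta n := B3GkZeroTorusRescaled.eta_pos (F.P K) n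
    have hW : (2 * ((4 : ℕ) * ((F.L : ℝ) ^ n * ((sideP (F.P K) M₀ ρ : ℕ) : ℝ) - 1)) + 1) * (F.P K).eta n ≤ 8 * ((sideP (F.P K) M₀ ρ : ℕ) : ℝ) := by
      have : (2 * ((4 : ℕ) * ((F.L : ℝ) ^ n * ((sideP (F.P K) M₀ ρ : ℕ) : ℝ) - 1)) + 1) * (F.P K).eta n =
          8 * ((sideP (F.P K) M₀ ρ : ℕ) : ℝ) * ((F.L : ℝ) ^ n * (F.P K).eta n) - 7 * (F.P K).eta n := by push_cast; ring
      rw [this, hη, mul_one]; linarith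
    have hr : 7 * (4 : ℕ) * (F.L : ℝ) ^ 2 * B₁ * ((sideP (F.P K) M₀ ρ : ℕ) : ℝ) * ((F.L : ℝ) ^ 3 * ε (n - 1)) ≤ 28 * (F.L : ℝ) ^ 5 * B₁ * M₂ * a0OfP F N M ρ B₁ c₁ := by
      have : 7 * (4 : ℕ) * (F.L : ℝ) ^ 2 * B₁ * ((sideP (F.P K) M₀ ρ : ℕ) : ℝ) * ((F.L : ℝ) ^ 3 * ε (n - 1)) =
          28 * (F.L : ℝ) ^ 5 * B₁ * ((sideP (F.P K) M₀ ρ : ℕ) : ℝ) * ε (n - 1) := by push_cast; ring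
      rw [this]; gcongr
    set X : ℝ := 8 * (M₂ : ℝ) * N * (28 * (F.L : ℝ) ^ 5 * B₁ * M₂) with hX
    have hX0 : 0 ≤ X := by positivity
    have hXa : X * a0OfP F N M ρ B₁ c₁ < 1 := by
      calc X * a0OfP F N M ρ B₁ c₁ ≤ X * (1 / (X + 1)) := mul_le_mul_of_nonneg_left ha₀w hX0
        _ < 1 := by rw [mul_one_div, div_lt_one (by positivity)]; linarith
    have hNr : (0 : ℝ) ≤ N := Nat.cast_nonneg N
    calc (2 * ((4 : ℕ) * ((F.L : ℝ) ^ n * ((sideP (F.P K) M₀ ρ : ℕ) : ℝ) - 1)) + 1) *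
          ((F.P K).eta n * N * (7 * (4 : ℕ) * (F.L : ℝ) ^ 2 * B₁ * ((sideP (F.P K) M₀ ρ : ℕ) : ℝ) * ((F.L : ℝ) ^ 3 * ε (n - 1))))
        = ((2 * ((4 : ℕ) * ((F.L : ℝ) ^ n * ((sideP (F.P K) M₀ ρ : ℕ) : ℝ) - 1)) + 1) * (F.P K).eta n) *
          (N * (7 * (4 : ℕ) * (F.L : ℝ) ^ 2 * B₁ * ((sideP (F.P K) M₀ ρ : ℕ) : ℝ) * ((F.L : ℝ) ^ 3 * ε (n - 1)))) := by ring
      _ ≤ (8 * ((sideP (F.P K) M₀ ρ : ℕ) : ℝ)) * (N * (28 * (F.L : ℝ) ^ 5 * B₁ * M₂ * a0OfP F N M ρ B₁ c₁)) := by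
          gcongr
      _ ≤ (8 * (M₂ : ℝ)) * (N * (28 * (F.L : ℝ) ^ 5 * B₁ * M₂ * a0OfP F N M ρ B₁ c₁)) := by gcongr
      _ = X * a0OfP F N M ρ B₁ c₁ := by rw [hX]; ring
      _ < 1 := hXa
      _ < 2 * Real.pi := by linarith [Real.pi_gt_three]
  obtain ⟨u, A, h1, h2, h3, h4, h4', h5⟩ :=
    exists_localGauge152_RE153_coverBox_propCubeP_of_prop6P (P := F.P K) hd hB₁ (dvd_refl ρ) hρ hP6 U h17 h19 hn1 (by omega) hnK hεn1 a
      hinj hcollar hc₁' h2π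
  -- the letters at `b9OfP·ε_n`
  have hbound : 2 * (7 * (F.P K).d * ((F.P K).L : ℝ) ^ 2 * B₁ * (propCubeP (F.P K) n hn1 M₀ ρ hρ a).M * (((F.P K).L : ℝ) ^ 3 * ε (n - 1))) <
      b9OfP F M ρ B₁ * ε n := by
    rw [propCubeP_M, T4Family.P_d, T4Family.P_L, b9OfP]
    have : 2 * (7 * (4 : ℕ) * (F.L : ℝ) ^ 2 * B₁ * ((sideP (F.P K) M₀ ρ : ℕ) : ℝ) * ((F.L : ℝ) ^ 3 * ε (n - 1))) =
        56 * (F.L : ℝ) ^ 5 * B₁ * ((sideP (F.P K) M₀ ρ : ℕ) : ℝ) * ε (n - 1) := by push_cast; ring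
    rw [this]
    calc 56 * (F.L : ℝ) ^ 5 * B₁ * ((sideP (F.P K) M₀ ρ : ℕ) : ℝ) * ε (n - 1) ≤ 56 * (F.L : ℝ) ^ 5 * B₁ * M₂ * (2 * ε n) := by gcongr
      _ = (112 * (F.L : ℝ) ^ 5 * B₁ * M₂) * ε n := by ring
      _ < (112 * (F.L : ℝ) ^ 5 * B₁ * ((F.L * M + 44 + 2 * ρ : ℕ) : ℝ) + 1) * ε n := by
          rw [hM₂]; exact mul_lt_mul_of_pos_right (lt_add_one _) hεn
  exact ⟨u, A, h1, fun b hb => (h2 b hb).trans_lt hbound, fun q hq => (h3 q hq).trans_lt hbound, fun b hb => (h4 b hb).trans_lt hbound,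
    fun b hb => (h4' b hb).trans_lt hbound, h5⟩

/-- ★ **THE SAME AT STUB 2′'s BARE `ρ₀ ≥ 1`** (`ρ := ρ₀·L ≥ L`, by `prop6Printed_zdCubP_anti`; floor `(11·4 + 4·(ρ₀L))·L`, constants `b9OfP F M (ρ₀L) B₁`, `a0OfP F N M (ρ₀L) B₁ c₁`).
[cite: Balaban1985Variational, (144)–(153) pp.300–301; Balaban1985RegularSpaces, Prop. 6 p.99, p.98 («M is a multiple of R₁M₁»); Balaban1984PropagatorsII, (2.12) p.225] -/
theorem gauge152_RE153_box_of_prop6P_of_one_le {B₁ c₁ : ℝ} (hB₁ : 0 ≤ B₁) (hc₁ : 0 < c₁) {ρ₀ : ℕ} (hρ₀ : 1 ≤ ρ₀)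
    (hP6 : letI : CStarAlgebra (MatA N) := {}; B8.Prop6Printed 4 (F.L : ℝ) B₁ c₁ (fun i : ZdIdx 4 F.L => zdCubP (MatA N) F.L ρ₀ i)) {M : ℕ} (hM : 1 ≤ M)
    (ν : Stage7Numerics) (g : ℕ → ℝ) (K k : ℕ) (s : SeqOfRecord F ν M g K k) (hsep : Sect2.SeqSeparated ν.M₁ s)
    (hfloor : (11 * 4 + 4 * (ρ₀ * F.L)) * F.L ≤ ν.M₁) (ε : ℕ → ℝ)
    (hε : ∀ m, m ≤ k → 0 < ε m ∧ ε m ≤ a0OfP F N M (ρ₀ * F.L) B₁ c₁) (hcomp : ∀ m, m < k → ε m ≤ 2 * ε (m + 1))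
    (U : GaugeField (F.P K) 0 (SU N))
    (h17 : ∀ m, m ≤ k → PlaqSmallOn (Sect2.omegaPlaqsTop s.Ω (suppDomOfRecord F ν K s.Ω) m) (ε m * (F.P K).eta m ^ 2) U)
    (h19 : ∀ m, m ≤ k → Sect2.CoDivSmallOn (Sect2.omegaBondsTop s.Ω (suppDomOfRecord F ν K s.Ω) m) (ε m * (F.P K).eta m ^ 3) U)
    {n : ℕ} (hn1 : 1 ≤ n) (hnk : n ≤ k) (hnK : n ≤ (F.P K).m + (F.P K).K) {M₀ : ℕ} (hM₀ : M₀ = M ∨ M₀ = F.L * M)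
    (a : Pt (F.P K).d) (hΩ : cubeEnl (F.P K) (side (F.P K).L M₀ n) a 0 ⊆ s.Ω n)
    (hinj : Set.InjOn (cover (F.P K))
      (cube (F.P K).L (propCubeP (F.P K) n hn1 M₀ (ρ₀ * F.L) (Nat.le_mul_of_pos_left F.L hρ₀) a).a
        (propCubeP (F.P K) n hn1 M₀ (ρ₀ * F.L) (Nat.le_mul_of_pos_left F.L hρ₀) a).M
        (propCubeP (F.P K) n hn1 M₀ (ρ₀ * F.L) (Nat.le_mul_of_pos_left F.L hρ₀) a).ρ n 0)) :
    ∃ u : GaugeTransf (F.P K) 0 (SU N), ∃ A : PBond (F.P K) 0 → MatA N,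
      (∀ b ∈ (Sect2.regionOfSet (F.P K)
          (cover (F.P K) '' box (F.P K).L (propCubeP (F.P K) n hn1 M₀ (ρ₀ * F.L) (Nat.le_mul_of_pos_left F.L hρ₀) a).a
            (propCubeP (F.P K) n hn1 M₀ (ρ₀ * F.L) (Nat.le_mul_of_pos_left F.L hρ₀) a).M n)).bonds,
          gaugeU (fun x => ιSU N (u x)) (fun b' => ιSU N (U b')) b = expI ((F.P K).eta n) (A b)) ∧
      (∀ b ∈ (Sect2.regionOfSet (F.P K)
          (cover (F.P K) '' box (F.P K).L (propCubeP (F.P K) n hn1 M₀ (ρ₀ * F.L) (Nat.le_mul_of_pos_left F.L hρ₀) a).a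
            (propCubeP (F.P K) n hn1 M₀ (ρ₀ * F.L) (Nat.le_mul_of_pos_left F.L hρ₀) a).M n)).bonds,
          ‖A b‖ < b9OfP F M (ρ₀ * F.L) B₁ * ε n) ∧
      (∀ q ∈ (Sect2.regionOfSet (F.P K)
          (cover (F.P K) '' box (F.P K).L (propCubeP (F.P K) n hn1 M₀ (ρ₀ * F.L) (Nat.le_mul_of_pos_left F.L hρ₀) a).a
            (propCubeP (F.P K) n hn1 M₀ (ρ₀ * F.L) (Nat.le_mul_of_pos_left F.L hρ₀) a).M n)).dpairs,
          ‖grad ((F.P K).eta n) q.2.1 (fun y => A ⟨y, q.2.2⟩) q.1‖ < b9OfP F M (ρ₀ * F.L) B₁ * ε n) ∧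
      (∀ b ∈ Sect2.bondsDeep (cover (F.P K) '' box (F.P K).L (propCubeP (F.P K) n hn1 M₀ (ρ₀ * F.L) (Nat.le_mul_of_pos_left F.L hρ₀) a).a
            (propCubeP (F.P K) n hn1 M₀ (ρ₀ * F.L) (Nat.le_mul_of_pos_left F.L hρ₀) a).M n),
          ‖Sect2.codiffCurlA ((F.P K).eta n) A b.src b.dir‖ < b9OfP F M (ρ₀ * F.L) B₁ * ε n) ∧
      (∀ b ∈ Sect2.bondsDeep (cover (F.P K) '' box (F.P K).L (propCubeP (F.P K) n hn1 M₀ (ρ₀ * F.L) (Nat.le_mul_of_pos_left F.L hρ₀) a).a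
            (propCubeP (F.P K) n hn1 M₀ (ρ₀ * F.L) (Nat.le_mul_of_pos_left F.L hρ₀) a).M n),
          ‖∑ ν' : Fin (F.P K).d, (((F.P K).eta n : ℝ) : ℂ)⁻¹ •
              (grad ((F.P K).eta n) ν' (fun y => A ⟨y, b.dir⟩) (b.src.unshift ν') - grad ((F.P K).eta n) ν' (fun y => A ⟨y, b.dir⟩) b.src)‖ <
            b9OfP F M (ρ₀ * F.L) B₁ * ε n) ∧
      (∀ φ : MatA N →L[ℂ] ℂ,
          RE (cubeDomains (F.P K) (propCubeP (F.P K) n hn1 M₀ (ρ₀ * F.L) (Nat.le_mul_of_pos_left F.L hρ₀) a).a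
                (propCubeP (F.P K) n hn1 M₀ (ρ₀ * F.L) (Nat.le_mul_of_pos_left F.L hρ₀) a).M (ρ₀ * F.L) n hnK) ((F.P K).eta n)⁻¹
              (dsE ((F.P K).eta n)⁻¹ (WithLp.toLp 2 fun b => (φ (A b)).re : BondSpace (F.P K))) = 0 ∧
          RE (cubeDomains (F.P K) (propCubeP (F.P K) n hn1 M₀ (ρ₀ * F.L) (Nat.le_mul_of_pos_left F.L hρ₀) a).a
                (propCubeP (F.P K) n hn1 M₀ (ρ₀ * F.L) (Nat.le_mul_of_pos_left F.L hρ₀) a).M (ρ₀ * F.L) n hnK) ((F.P K).eta n)⁻¹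
              (dsE ((F.P K).eta n)⁻¹ (WithLp.toLp 2 fun b => (φ (A b)).im : BondSpace (F.P K))) = 0) := by
  letI : CStarAlgebra (MatA N) := {}
  exact gauge152_RE153_box_of_prop6P hB₁ hc₁ (prop6Printed_zdCubP_anti (fun i : ZdIdx 4 F.L => i) (Dvd.intro F.L rfl) hP6) hM ν g K k
    (Nat.le_mul_of_pos_left F.L hρ₀) s hsep hfloor ε hε hcomp U h17 h19 hn1 hnk hnK hM₀ a hΩ hinj

end Wrapper

/-! ## §2  ★★ The (9)–(10) composition for critical configurations: stub 1's fact ∧ Prop. 6 on print's class, box window -/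

section NineStep

/-- ★★ **[15] THM 1 (9) line 1 AND (10) — BOTH MEMBERS — ON THE BOX WINDOW `π(𝔔)`, WITH (153) `R ∂*a = 0` FOR THE SAME POTENTIAL, FOR CRITICAL CONFIGURATIONS ⟸ [15] PROP. 8's
TOP STEP ∧ [6] PROP. 6 ON PRINT'S CLASS** — generation 0's `gauge9_152_153_of_prop8TopStep_of_prop6P` shape re-run through `gauge152_RE153_box_of_prop6P` at the radii `B₃δ_•`
of (8): for a CRITICAL `U` on the fibre of a (7)-datum `W` in the (1.7)∕(1.9)-Top class at `ε₀` (34c's binder block with the floor `(11·4 + 4ρ)·L ≤ ν.M₁`; `0 < B₃`,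
`B₃a₁ ≤ a0OfP`; `1 ≤ M`), on the box window of the print datum of every grid cube of the two families (non-wrapping of the datum's collared cube displayed) the five clauses at
`b9OfP·B₃·δ_n` and `R ∂*a = 0` on `cubeDomains`.  Stub 1's `Prop8RegSepTopStep` is the HYPOTHESIS `h8`, Prop. 6 on print's class the HYPOTHESIS `hP6`.
[cite: Balaban1985Variational, Thm 1 (8)–(10) p.279, Sect. F pp.300–305, Prop. 8 p.304, (152)–(153) p.301; Balaban1985RegularSpaces, Prop. 6 p.99; Balaban1984PropagatorsII, (2.12) p.225] -/
theorem gauge9_152_RE153_box_of_prop8TopStep_of_prop6P {B₁ c₁ B₃ a₀ a₁ : ℝ} (hB₁ : 0 ≤ B₁) (hc₁ : 0 < c₁) {ρ : ℕ}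
    (hP6 : letI : CStarAlgebra (MatA N) := {}; B8.Prop6Printed 4 (F.L : ℝ) B₁ c₁ (fun i : ZdIdx 4 F.L => zdCubP (MatA N) F.L ρ i)) {M : ℕ} (hM : 1 ≤ M)
    (h8 : Prop8RegSepTopStep F N (fun ν K Ω => suppDomOfRecord F ν K Ω) B₃ a₀ a₁) (hB₃ : 0 < B₃) (ha : B₃ * a₁ ≤ a0OfP F N M ρ B₁ c₁)
    (ν : Stage7Numerics) (g : ℕ → ℝ) (K k : ℕ) (hρ : (F.P K).L ≤ ρ) (s : SeqOfRecord F ν M g K k) (hsep : Sect2.SeqSeparated ν.M₁ s) (hM₁ : 0 < ν.M₁)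
    (hfloor : (11 * 4 + 4 * ρ) * F.L ≤ ν.M₁) (hk : 1 ≤ k) (ε₀ : ℝ) (δ : ℕ → ℝ)
    (hδ : ∀ m, m ≤ k → 0 < δ m ∧ δ m ≤ a₁ ∧ B₃ * δ m ≤ ε₀) (hcomp : ∀ m, m < k → δ m ≤ 2 * δ (m + 1)) (hcomp' : ∀ m, m < k → δ (m + 1) ≤ 2 * δ m)
    (hε₀ : ε₀ ≤ a₀) (W : MSField (F.P K) (SU N)) (h7 : Sect2.DataSmall7PTop (avOfRecord F N K) s.Ω (suppDomOfRecord F ν K s.Ω) k δ W)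
    (U : GaugeField (F.P K) 0 (SU N))
    (h17 : ∀ m, m ≤ k → PlaqSmallOn (Sect2.omegaPlaqsTop s.Ω (suppDomOfRecord F ν K s.Ω) m) (ε₀ * (F.P K).eta m ^ 2) U)
    (h19 : Sect2.CoDivClassOnTop s.Ω (suppDomOfRecord F ν K s.Ω) k ε₀ U) (hfib : AgreeOn (genSet s.Ω k) (avgFamily (avOfRecord F N K) U) W)
    (hcrit : IsCritOnFibre F N K (genSet s.Ω k) W U)
    {n : ℕ} (hn1 : 1 ≤ n) (hnk : n ≤ k) (hnK : n ≤ (F.P K).m + (F.P K).K) {M₀ : ℕ} (hM₀ : M₀ = M ∨ M₀ = F.L * M)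
    (a : Pt (F.P K).d) (hΩ : cubeEnl (F.P K) (side (F.P K).L M₀ n) a 0 ⊆ s.Ω n)
    (hinj : Set.InjOn (cover (F.P K))
      (cube (F.P K).L (propCubeP (F.P K) n hn1 M₀ ρ hρ a).a (propCubeP (F.P K) n hn1 M₀ ρ hρ a).M (propCubeP (F.P K) n hn1 M₀ ρ hρ a).ρ n 0)) :
    ∃ u : GaugeTransf (F.P K) 0 (SU N), ∃ A : PBond (F.P K) 0 → MatA N,
      (∀ b ∈ (Sect2.regionOfSet (F.P K)
          (cover (F.P K) '' box (F.P K).L (propCubeP (F.P K) n hn1 M₀ ρ hρ a).a (propCubeP (F.P K) n hn1 M₀ ρ hρ a).M n)).bonds,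
          gaugeU (fun x => ιSU N (u x)) (fun b' => ιSU N (U b')) b = expI ((F.P K).eta n) (A b)) ∧
      (∀ b ∈ (Sect2.regionOfSet (F.P K)
          (cover (F.P K) '' box (F.P K).L (propCubeP (F.P K) n hn1 M₀ ρ hρ a).a (propCubeP (F.P K) n hn1 M₀ ρ hρ a).M n)).bonds,
          ‖A b‖ < b9OfP F M ρ B₁ * B₃ * δ n) ∧
      (∀ q ∈ (Sect2.regionOfSet (F.P K)
          (cover (F.P K) '' box (F.P K).L (propCubeP (F.P K) n hn1 M₀ ρ hρ a).a (propCubeP (F.P K) n hn1 M₀ ρ hρ a).M n)).dpairs,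
          ‖grad ((F.P K).eta n) q.2.1 (fun y => A ⟨y, q.2.2⟩) q.1‖ < b9OfP F M ρ B₁ * B₃ * δ n) ∧
      (∀ b ∈ Sect2.bondsDeep (cover (F.P K) '' box (F.P K).L (propCubeP (F.P K) n hn1 M₀ ρ hρ a).a (propCubeP (F.P K) n hn1 M₀ ρ hρ a).M n),
          ‖Sect2.codiffCurlA ((F.P K).eta n) A b.src b.dir‖ < b9OfP F M ρ B₁ * B₃ * δ n) ∧
      (∀ b ∈ Sect2.bondsDeep (cover (F.P K) '' box (F.P K).L (propCubeP (F.P K) n hn1 M₀ ρ hρ a).a (propCubeP (F.P K) n hn1 M₀ ρ hρ a).M n),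
          ‖∑ ν' : Fin (F.P K).d, (((F.P K).eta n : ℝ) : ℂ)⁻¹ •
              (grad ((F.P K).eta n) ν' (fun y => A ⟨y, b.dir⟩) (b.src.unshift ν') - grad ((F.P K).eta n) ν' (fun y => A ⟨y, b.dir⟩) b.src)‖ <
            b9OfP F M ρ B₁ * B₃ * δ n) ∧
      (∀ φ : MatA N →L[ℂ] ℂ,
          RE (cubeDomains (F.P K) (propCubeP (F.P K) n hn1 M₀ ρ hρ a).a (propCubeP (F.P K) n hn1 M₀ ρ hρ a).M ρ n hnK) ((F.P K).eta n)⁻¹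
              (dsE ((F.P K).eta n)⁻¹ (WithLp.toLp 2 fun b => (φ (A b)).re : BondSpace (F.P K))) = 0 ∧
          RE (cubeDomains (F.P K) (propCubeP (F.P K) n hn1 M₀ ρ hρ a).a (propCubeP (F.P K) n hn1 M₀ ρ hρ a).M ρ n hnK) ((F.P K).eta n)⁻¹
              (dsE ((F.P K).eta n)⁻¹ (WithLp.toLp 2 fun b => (φ (A b)).im : BondSpace (F.P K))) = 0) := by
  obtain ⟨h8p, h8c⟩ := h8 ν M g K k s hsep hM₁ hk ε₀ δ hδ hcomp hcomp' hε₀ W h7 U h17 h19 hfib hcrit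
  have hε : ∀ m, m ≤ k → 0 < B₃ * δ m ∧ B₃ * δ m ≤ a0OfP F N M ρ B₁ c₁ := fun m hm =>
    ⟨mul_pos hB₃ (hδ m hm).1, (mul_le_mul_of_nonneg_left (hδ m hm).2.1 hB₃.le).trans ha⟩
  have hc1 : ∀ m, m < k → B₃ * δ m ≤ 2 * (B₃ * δ (m + 1)) := fun m hm => by
    have := mul_le_mul_of_nonneg_left (hcomp m hm) hB₃.le; linarith
  have h := gauge152_RE153_box_of_prop6P hB₁ hc₁ hP6 hM ν g K k hρ s hsep hfloor (fun m => B₃ * δ m) hε hc1 U h8p h8c hn1 hnk hnK hM₀ a hΩ hinj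
  rw [show b9OfP F M ρ B₁ * B₃ * δ n = b9OfP F M ρ B₁ * (B₃ * δ n) by ring]
  exact h

end NineStep

#print axioms gauge152_RE153_box_of_prop6P
#print axioms gauge9_152_RE153_box_of_prop8TopStep_of_prop6P

end Literature.MathematicalPhysics.QuantumFieldTheory.Balaban1983to89.Node00

end
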